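import Literature.AlgebraicGeometry.Motives.BettiHodgeClassicalPin
import Literature.AlgebraicGeometry.Motives.PeriodRealizationClassical
import Literature.AlgebraicGeometry.HodgeTheory.HodgeFiltrationModels
import Literature.AlgebraicGeometry.HodgeTheory.HodgeStructureOfHodgeModel
import HarnessLib

/-!
# A pinned Betti–Hodge datum forces model-independence of the Hodge types

`BettiHodgeData.IsClassicalHodge B` (`Motives/BettiHodgeClassicalPin`; clauses (i)/(i') of
`BettiHodgeData.IsClassical`, `Motives/PeriodRealizationClassical`) pins the Hodge pieces of
`B.hodge hX i` to the preimages of `H^{p,q}(X^an)` under `Φ_A : ℂ ⊗_ℚ Hⁱ(X) → Hⁱ(X^an; ℂ)` for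
EVERY Hodge model `A` of the smooth projective `X`. Since `Φ_A = φ_A^* ∘ (B.comparison X i)` with
`B.comparison X i` SURJECTIVE (`B.iso ⊗ ℂ` is an isomorphism and `ℂ ⊗_ℚ Hⁱ(X(ℂ); ℚ) → Hⁱ(X(ℂ); ℂ)`
is onto for smooth projective `X`, `HodgeTheory.ofRatClassBaseChange_surjective` — universal
coefficients, Voisin I §7.1.1 / Hatcher Thm. 3.2), two Hodge models `A`, `A'` then cut out the same
classes of `Hⁱ(X(ℂ); ℂ)`: the pin IMPLIES the tree's named fact
`HodgeTheory.hodgePQ_independent_of_hodgeModel` ("all Hodge models of a smooth projective `X` give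
the same `H^{p,q}` on `X(ℂ)`", module docstring of `HodgeTheory/RationalHodgeClasses`; reduced to
`NaturalDeRhamComparisonRigidity` in `HodgeTheory/HodgeFiltrationModelsRigidity`).

Consequently every statement positing a pinned datum — `∃ B, B.IsClassicalHodge`
(`PeriodsPolice.ClassicalBridge`), `∃ B, B.IsClassical` (`PeriodDeficiency.ClassicalGeometricVHS`) —
is at least as strong as that named fact: no such `B` can be exhibited before it is proved.

* `BettiHodgeData.comparison_surjective` — `B.comparison X i` is onto for smooth projective `X`.
* `BettiHodgeData.IsClassicalHodge.hodgePQ_independent`, `BettiHodgeData.IsClassical.hodgePQ_independent`,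
  `hodgePQ_independent_of_exists_isClassicalHodge`.

## References

* C. Voisin, *Hodge Theory and Complex Algebraic Geometry I* (2002), §6.1.3 Prop. 6.11, §7.1.1.
* A. Hatcher, *Algebraic Topology* (2002), §3.1, Thm. 3.2.
* J.-P. Serre, *GAGA* (1956), §2.
-/

noncomputable section

open scoped TensorProduct
open CategoryTheory

namespace Literature.AlgebraicGeometry.Motives

open Literature.AlgebraicGeometry.HodgeTheory Literature.AlgebraicTopology.SingularHomology

namespace BettiHodgeData

variable (B : BettiHodgeData ℂ) {n : ℕ} {X : SchemeOver ℂ}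

/-- **The comparison `ℂ ⊗_ℚ Hⁱ(X) → Hⁱ(X(ℂ); ℂ)` of a Betti–Hodge datum is surjective** for `X`
smooth projective: it is `B.iso ⊗ ℂ` (an isomorphism) followed by the complexified change of
coefficients `ℂ ⊗_ℚ Hⁱ(X(ℂ); ℚ) → Hⁱ(X(ℂ); ℂ)`, which is onto (`ofRatClassBaseChange_surjective`;
universal coefficients, Voisin I §7.1.1). [cite: VoisinHodgeI2002, §7.1.1] -/
theorem comparison_surjective (hX : IsSmoothProjective n X) (i : ℕ) :
    Function.Surjective (B.comparison X i) := by
  intro c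
  obtain ⟨y, hy⟩ := ofRatClassBaseChange_surjective hX i c
  refine ⟨((B.isoObj X i).baseChange ℚ ℂ _ _).symm y, ?_⟩
  rw [← complexComparison_eq_comparison, complexComparison, LinearMap.comp_apply,
    ← LinearEquiv.coe_baseChange, LinearEquiv.coe_coe, LinearEquiv.apply_symm_apply]
  exact hy

/-- **A Hodge-pinned datum forces model-independence of Hodge types**: if `B.hodge` is pinned to
`H^{p,q}(X^an)` through every Hodge model (`IsClassicalHodge`), then for any two Hodge models
`A`, `A'` of a smooth projective `X` and any `c ∈ Hᵏ(X(ℂ); ℂ)`, `φ_A^* c ∈ H^{p,q}_A` implies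
`φ_{A'}^* c ∈ H^{p,q}_{A'}` — the named fact `HodgeTheory.hodgePQ_independent_of_hodgeModel`.
(Write `c = B.comparison X k x`; both memberships say `x ∈ V^{p,q}`; for `p + q ≠ k` both
`H^{p,q}` vanish and `φ_A^*` is injective.) [cite: VoisinHodgeI2002, §6.1.3 Prop. 6.11 and §7.1.1] -/
theorem IsClassicalHodge.hodgePQ_independent {B : BettiHodgeData ℂ} (h : B.IsClassicalHodge) :
    hodgePQ_independent_of_hodgeModel := by
  intro n X hX A A' k p q c hc
  by_cases hpq : p + q = k
  · obtain ⟨x, rfl⟩ := B.comparison_surjective hX k c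
    have hx : x ∈ (B.hodge hX k).piece p q := (h.mem_piece_iff hX A hpq x).2 hc
    exact (h.mem_piece_iff hX A' hpq x).1 hx
  · have hA : A.hodgePQ k p q = ⊥ :=
      (A.hodgePQ_eq_bot_iff k p q).2 (Literature.NumberTheory.Transcendental.hodgePQ_eq_bot_of_ne hpq)
    have hA' : A'.hodgePQ k p q = ⊥ :=
      (A'.hodgePQ_eq_bot_iff k p q).2 (Literature.NumberTheory.Transcendental.hodgePQ_eq_bot_of_ne hpq)
    rw [hA, Submodule.mem_bot] at hc
    have hc0 : c = 0 := A.pullback_injective k (by rw [hc, map_zero])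
    rw [hA', hc0, map_zero]
    exact Submodule.zero_mem _

/-- The same for the full predicate `IsClassical` (which projects onto the pin).
[cite: VoisinHodgeI2002, §7.1.1] -/
theorem IsClassical.hodgePQ_independent {B : BettiHodgeData ℂ} (h : B.IsClassical) :
    hodgePQ_independent_of_hodgeModel :=
  h.isClassicalHodge.hodgePQ_independent

end BettiHodgeData

/-- **No pinned datum before model-independence**: the existence of a Hodge-pinned Betti–Hodge
datum (`∃ B, B.IsClassicalHodge`, posited by `PeriodsPolice.ClassicalBridge` and, through
`IsClassical`, by `PeriodDeficiency.ClassicalGeometricVHS`) implies the named fact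
`HodgeTheory.hodgePQ_independent_of_hodgeModel`. [cite: VoisinHodgeI2002, §6.1.3 Prop. 6.11] -/
theorem hodgePQ_independent_of_exists_isClassicalHodge (h : ∃ B : BettiHodgeData ℂ, B.IsClassicalHodge) :
    hodgePQ_independent_of_hodgeModel := by
  obtain ⟨_, hB⟩ := h
  exact hB.hodgePQ_independent

end Literature.AlgebraicGeometry.Motives

end
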